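import Literature.Analysis.FluidPDE.ChaeWolfDSSDecayScaling
import Literature.Analysis.FluidPDE.ClassicalL3Mild
import Literature.Analysis.FluidPDE.KatoFarFieldBound
import Literature.Analysis.FluidPDE.TaoQuantitativeReduction
import HarnessLib

/-!
# Chae–Wolf 2017, Theorem 1.1, for `u ∈ C((−∞,0); L³)` (the critical case `p = 3`)

Analysis/FluidPDE proofs file (theorems only) on the discharge path of the named fact
`Literature.Analysis.FluidPDE.chaeWolf2017_dss_typeI_decay` (`ChaeWolfRemovingDSS.lean`;
D. Chae, J. Wolf, *Removing discretely self-similar singularities for the 3D Navier–Stokes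
equations*, Comm. PDE 42 (2017) 1359–1374 = arXiv:1610.09464, **Theorem 1.1**: "For `3 ≤ p < ∞`
let `u ∈ C((−∞, 0); Lᵖ(ℝ³)) ∩ C^∞(Q)` be a solution to the Navier–Stokes equations, and `λ`-DSS
for some `λ ∈ (1, ∞)`. Then `u` is regular on `Q̄ ∖ {(0,0)}` and satisfies
`|u(x,t)| ≤ C/(√(−t) + |x|)` (1.5)").

This file **proves the case `p = 3`** of the fact (`chaeWolf2017_dss_typeI_decay_three`, literally
the instance `q = 3` of the body of `chaeWolf2017_dss_typeI_decay`). The printed proof (§2,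
Steps 1–4) runs through the local energy inequality up to `t = 0` and Wolf's pressure-free
`ε`-regularity criterion for local suitable weak solutions (Ann. Univ. Ferrara 61 (2015)), which
the tree does not have. For `p = 3` the regularity input — boundedness of `u` near
`{t = 0} × {x ≠ 0}` — is instead obtained from the tree's **Kato theory**: a classical solution
with slices in `C((−∞,0); L³)` is, after the pressure normalisation of
`PressureNormalisationL3` (Tao 2011, Lemma 4.1 (i) in `L³`) and the duality computation of
`ClassicalL3Mild` (Fabes–Jones–Rivière 1972, Thm. 2.1 in `L³`), a **Kato solution** on every
window `[t₀, 0)` (mild, `C_t L³`), and Kato solutions are essentially bounded on a far-field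
region `(T − δ, T) × {|x| > R}` up to their final time (`IsKatoSolutionOn.farField_bound_holds`,
Lemarié-Rieusset 2016, proof of Thm. 15.1 (C), via the Calderón splitting, the energy class of
the caloric remainder and the Caffarelli–Kohn–Nirenberg `ε`-regularity criterion Thm. 14.4). By
continuity the bound is pointwise, and **Step 5** of the printed proof (discrete self-similarity,
`ChaeWolfDSSDecayScaling.lean`) turns it into the Type I bound (1.5) on all of `Q`. The uniform
`L³` bound needed by the normalisation is Remark 1.2 of the paper ("If `u ∈ C((−∞,0); L³)` and
discretely self-similar, then `u ∈ L^∞(−∞, 0; L³)`": `sup` over one period strip by continuity,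
then scale invariance of the `L³` norm, `eLpNorm_nsRescale_three`).

The cases `3 < p < ∞` of the fact are NOT proved here (no pressure-free `ε`-regularity in the
tree; for `p ≥ 9` even the a priori `L^{3/2}_{loc}` integrability of the pressure up to `t = 0`
fails, so no pressure-ful criterion applies).

## Mathlib / tree search

Tree: `IsKatoSolutionOn`, `IsKatoSolutionOn.farField_bound_holds` (`KatoFarFieldBound`),
`ClassicalL3Mild.isMildNSSolutionOn_of_memLp_three`, `IsClassicalNSSolutionOn.comp_add_right`
(`ClassicalSolutionGlue`), `eLpNorm_nsRescale_three` (`TaoQuantitativeReduction`),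
`IsDiscretelySelfSimilar.zpow`, `ChaeWolfDecay.exists_hasTypeIDecay_of_farField_bound`
(`ChaeWolfDSSDecayScaling`); `lean search 'chaeWolf2017_dss_typeI_decay'`: no earlier partial
discharge. Mathlib: `IsCompact.exists_isMaxOn`, `exists_mem_Ico_zpow`,
`enorm_ae_le_eLpNormEssSup`, `ContinuousWithinAt.tendsto_nhdsWithin`.

## References

* D. Chae, J. Wolf, Comm. PDE 42 (2017) = arXiv:1610.09464: Thm. 1.1 with (1.5), Remark 1.2
  (p. 3); §2, Steps 1–5 (pp. 5–7). [ChaeWolf2017RemovingDSS]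
* P. G. Lemarié-Rieusset, *The Navier–Stokes Problem in the 21st Century* (2016), Thm. 15.1 (C)
  and its proof, Thm. 14.4. [LemarieRieusset2016]
* T. Kato, Math. Z. 187 (1984), Thm. 1. [Kato1984]
-/

noncomputable section

open MeasureTheory Set Filter Metric Function
open _root_.Topology
open scoped ENNReal NNReal

namespace Literature.Analysis.FluidPDE

namespace ChaeWolfDecay

variable {c : ℝ} {u : ℝ → EuclideanSpace ℝ (Fin 3) → EuclideanSpace ℝ (Fin 3)}

/-! ### Remark 1.2: `C_t L³` + DSS ⇒ `L^∞_t L³` -/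

/-- **Scale invariance of the `L³` norm along a DSS field**: `‖u(t)‖_{L³} = ‖u(c²ⁿt)‖_{L³}` for
a `c`-DSS field, `c > 0`, `n ∈ ℤ` (the `L³(ℝ³)` norm is invariant under `w ↦ γ w(γ ·)`,
`eLpNorm_nsRescale_three`). [cite: ChaeWolf2017RemovingDSS, Remark 1.2 (arXiv p. 3)] -/
theorem eLpNorm_three_eq_of_dss (hc : 0 < c) (hdss : IsDiscretelySelfSimilar c u) (n : ℤ)
    (t : ℝ) : eLpNorm (u t) 3 volume = eLpNorm (u ((c ^ n) ^ 2 * t)) 3 volume := by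
  have h := eLpNorm_nsRescale_three u (zpow_pos hc n) t
  rwa [hdss.zpow hc.ne' n] at h

/-- Continuity in `L³` gives continuity of the `L³` norm (within `(−∞, 0)`). [folklore] -/
theorem continuousWithinAt_eLpNorm (h3 : ∀ t < 0, MemLp (u t) 3 volume)
    (hcont : ∀ t₀ < 0, Tendsto (fun t => eLpNorm (u t - u t₀) 3 volume) (𝓝[Iio 0] t₀) (𝓝 0))
    {t₀ : ℝ} (ht₀ : t₀ < 0) :
    ContinuousWithinAt (fun t => eLpNorm (u t) 3 volume) (Iio 0) t₀ := by
  set N : ℝ → ℝ≥0∞ := fun t => eLpNorm (u t) 3 volume with hN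
  set e : ℝ → ℝ≥0∞ := fun t => eLpNorm (u t - u t₀) 3 volume with he
  have hm : ∀ t < 0, AEStronglyMeasurable (u t) volume := fun t ht => (h3 t ht).1
  have hev : ∀ᶠ t in 𝓝[Iio 0] t₀, t < 0 := eventually_mem_nhdsWithin
  -- `N t₀ - e t ≤ N t ≤ N t₀ + e t`
  have hup : ∀ᶠ t in 𝓝[Iio 0] t₀, N t ≤ N t₀ + e t := by
    filter_upwards [hev] with t ht
    have eq : u t = (u t - u t₀) + u t₀ := by abel
    calc N t = eLpNorm ((u t - u t₀) + u t₀) 3 volume := by rw [hN]; exact congrArg (eLpNorm · 3 volume) eq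
      _ ≤ e t + N t₀ := eLpNorm_add_le ((hm t ht).sub (hm t₀ ht₀)) (hm t₀ ht₀) (by norm_num)
      _ = N t₀ + e t := add_comm _ _
  have hlow : ∀ᶠ t in 𝓝[Iio 0] t₀, N t₀ - e t ≤ N t := by
    filter_upwards [hev] with t ht
    have eq : u t₀ = (u t₀ - u t) + u t := by abel
    have h1 : N t₀ ≤ e t + N t := by
      calc N t₀ = eLpNorm ((u t₀ - u t) + u t) 3 volume := by
            rw [hN]; exact congrArg (eLpNorm · 3 volume) eq
        _ ≤ eLpNorm (u t₀ - u t) 3 volume + N t :=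
            eLpNorm_add_le ((hm t₀ ht₀).sub (hm t ht)) (hm t ht) (by norm_num)
        _ = e t + N t := by rw [he, eLpNorm_sub_comm]
    exact tsub_le_iff_right.2 (by rwa [add_comm] at h1)
  have hfin : N t₀ ≠ ⊤ := (h3 t₀ ht₀).eLpNorm_ne_top
  have hlim_up : Tendsto (fun t => N t₀ + e t) (𝓝[Iio 0] t₀) (𝓝 (N t₀)) := by
    have := (tendsto_const_nhds (x := N t₀)).add (hcont t₀ ht₀)
    rwa [add_zero] at this
  have hlim_low : Tendsto (fun t => N t₀ - e t) (𝓝[Iio 0] t₀) (𝓝 (N t₀)) := by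
    have := ENNReal.Tendsto.sub (tendsto_const_nhds (x := N t₀)) (hcont t₀ ht₀) (Or.inl hfin)
    rwa [tsub_zero] at this
  exact tendsto_of_tendsto_of_tendsto_of_le_of_le' hlim_low hlim_up hlow hup

/-- **Remark 1.2** ("If `u ∈ C((−∞, 0); L³(ℝ³))`, and discretely self-similar, then
`u ∈ L^∞(−∞, 0; L³(ℝ³))`"): the `L³` norm is bounded on the compact period strip
`[−c², −1]` by continuity, and every `t < 0` is carried into the strip by a power of the scaling,
which preserves the `L³` norm. [cite: ChaeWolf2017RemovingDSS, Remark 1.2 (arXiv p. 3)] -/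
theorem exists_eLpNorm_three_le (hc : 1 < c) (hdss : IsDiscretelySelfSimilar c u)
    (h3 : ∀ t < 0, MemLp (u t) 3 volume)
    (hcont : ∀ t₀ < 0, Tendsto (fun t => eLpNorm (u t - u t₀) 3 volume) (𝓝[Iio 0] t₀) (𝓝 0)) :
    ∃ M : ℝ≥0, ∀ t < 0, eLpNorm (u t) 3 volume ≤ M := by
  have hc0 : 0 < c := one_pos.trans hc
  set N : ℝ → ℝ≥0∞ := fun t => eLpNorm (u t) 3 volume with hN
  set K : Set ℝ := Icc (-c ^ 2) (-1) with hK
  have hKc : IsCompact K := isCompact_Icc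
  have hc2 : 1 < c ^ 2 := by nlinarith
  have hKne : K.Nonempty := ⟨-1, by rw [hK]; exact ⟨by linarith, le_rfl⟩⟩
  have hKneg : ∀ s ∈ K, s < 0 := fun s hs => by linarith [hs.2]
  have hNc : ContinuousOn N K := fun s hs =>
    (continuousWithinAt_eLpNorm h3 hcont (hKneg s hs)).mono fun r hr => hKneg r hr
  obtain ⟨s₀, hs₀, hmax⟩ := hKc.exists_isMaxOn hKne hNc
  have hfin : N s₀ < ⊤ := (h3 s₀ (hKneg s₀ hs₀)).eLpNorm_lt_top
  refine ⟨(N s₀).toNNReal, fun t ht => ?_⟩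
  rw [ENNReal.coe_toNNReal hfin.ne]
  -- carry `t` into the strip: `(c²)^m ≤ -t < (c²)^(m+1)`, `γ = c^(-m)`
  have hnt : 0 < -t := neg_pos.2 ht
  obtain ⟨m, hm1, hm2⟩ := exists_mem_Ico_zpow hnt hc2
  have hg0 : 0 < (c ^ 2) ^ m := zpow_pos (by positivity) m
  have hsq : (c ^ (-m)) ^ 2 = ((c ^ 2) ^ m)⁻¹ := by
    rw [zpow_neg, inv_pow, ← zpow_natCast (c ^ m) 2, ← zpow_mul, mul_comm, zpow_mul, zpow_natCast]
  have hmem : (c ^ (-m)) ^ 2 * t ∈ K := by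
    rw [hsq, hK]
    constructor
    · -- `-t < (c²)^(m+1) = (c²)^m c²` gives `((c²)^m)⁻¹ t ≥ -c²`
      rw [zpow_add_one₀ (by positivity) m] at hm2
      rw [inv_mul_eq_div, le_div_iff₀ hg0]
      nlinarith
    · rw [inv_mul_eq_div, div_le_iff₀ hg0]
      nlinarith
  calc N t = N ((c ^ (-m)) ^ 2 * t) := eLpNorm_three_eq_of_dss hc0 hdss (-m) t
    _ ≤ N s₀ := hmax hmem

/-! ### From an essential to a pointwise far-field bound -/

/-- If `w` is jointly continuous on an open `W ⊆ ℝ × ℝ³` and essentially bounded by `M` on an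
open `V ⊆ W`, then `‖w‖ ≤ M` everywhere on `V` (an open null set is empty; the argument of
`NecasRuzickaSverakEpsilon.forall_norm_le_of_ae_restrict`). [folklore] -/
private theorem forall_norm_le_of_ae_restrict' {w : ℝ → EuclideanSpace ℝ (Fin 3) → EuclideanSpace ℝ (Fin 3)}
    {W V : Set (ℝ × EuclideanSpace ℝ (Fin 3))} (hw : ContinuousOn (uncurry w) W) (hV : IsOpen V)
    (hVW : V ⊆ W) {M : ℝ} (h : ∀ᵐ z ∂(volume.restrict V), ‖w z.1 z.2‖ ≤ M) :
    ∀ z ∈ V, ‖w z.1 z.2‖ ≤ M := by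
  have hopen : IsOpen (V ∩ (uncurry w) ⁻¹' {v | M < ‖v‖}) :=
    (hw.mono hVW).isOpen_inter_preimage hV (isOpen_lt continuous_const continuous_norm)
  have hae : ∀ᵐ z ∂(volume : Measure (ℝ × EuclideanSpace ℝ (Fin 3))),
      z ∉ V ∩ (uncurry w) ⁻¹' {v | M < ‖v‖} := by
    rw [ae_restrict_iff' hV.measurableSet] at h
    filter_upwards [h] with z hz hmem
    exact (not_lt.2 (hz hmem.1)) hmem.2
  have hnull : volume (V ∩ (uncurry w) ⁻¹' {v | M < ‖v‖}) = 0 := by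
    rw [ae_iff] at hae
    simpa only [not_not, setOf_mem_eq] using hae
  intro z hzV
  by_contra hlt
  have hmem : z ∈ V ∩ (uncurry w) ⁻¹' {v | M < ‖v‖} := ⟨hzV, not_le.1 hlt⟩
  exact (hopen.measure_pos volume ⟨z, hmem⟩).ne' hnull

/-! ### Theorem 1.1 for `p = 3` -/

/-- **Chae–Wolf 2017, Theorem 1.1, case `p = 3` (proved).** Let `(u, p)` be a classical
solution of the unforced Navier–Stokes equations with viscosity `1` on the time set `(−∞, 0)`
whose slices `u(t)`, `t < 0`, lie in `L³(ℝ³)` and depend continuously on `t` in `L³` (the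
printed `u ∈ C((−∞,0); L³) ∩ C^∞(Q)`), and which is `c`-discretely self-similar for some
`c > 1`. Then `u` obeys a Type I bound `‖u(t,x)‖ ≤ C/(‖x‖ + √(−t))` (`HasTypeIDecay C u`; the
printed (1.5), which contains the regularity on `Q̄ ∖ {(0,0)}`). Proof: module docstring
(Remark 1.2 ⇒ uniform `L³` bound; time shift; pressure normalisation + duality ⇒ Kato solution on
`[0, 1)`; far-field bound of Kato solutions up to the final time; continuity; Step 5). [cite: ChaeWolf2017RemovingDSS, Theorem 1.1 with (1.5), case p = 3, and Remark 1.2 (arXiv p. 3)] -/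
theorem exists_hasTypeIDecay_of_memLp_three (hc : 1 < c)
    {p : ℝ → EuclideanSpace ℝ (Fin 3) → ℝ} (hsol : IsClassicalNSSolutionOn (Iio 0) 1 0 u p)
    (h3 : ∀ t < 0, MemLp (u t) 3 volume)
    (hcont : ∀ t₀ < 0, Tendsto (fun t => eLpNorm (u t - u t₀) 3 volume) (𝓝[Iio 0] t₀) (𝓝 0))
    (hdss : IsDiscretelySelfSimilar c u) : ∃ C : ℝ, HasTypeIDecay C u := by
  -- Remark 1.2: the uniform `L³` bound
  obtain ⟨M, hM⟩ := exists_eLpNorm_three_le hc hdss h3 hcont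
  -- the shifted solution `ũ s = u (s - 1)` on `(-∞, 1)`
  have h1 := hsol.comp_add_right (-1)
  have hset : (fun t : ℝ => t + (-1)) ⁻¹' Iio 0 = Iio 1 := by
    ext t
    simp only [mem_preimage, mem_Iio]
    constructor <;> intro h <;> linarith
  rw [hset] at h1
  have hsol' : IsClassicalNSSolutionOn (Ioo (-1) 1) 1 0 (fun s => u (s + (-1)))
      (fun s => p (s + (-1))) :=
    h1.mono (fun s hs => hs.2) isOpen_Ioo.uniqueDiffOn
  have h3' : ∀ s ∈ Ioo (-1 : ℝ) 1, MemLp (u (s + (-1))) 3 volume := fun s hs =>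
    h3 _ (by linarith [hs.2])
  have hM' : ∀ s ∈ Ioo (-1 : ℝ) 1, eLpNorm (u (s + (-1))) 3 volume ≤ M := fun s hs =>
    hM _ (by linarith [hs.2])
  -- Kato solution on `[0, 1)`
  have hmild := ClassicalL3Mild.isMildNSSolutionOn_of_memLp_three hsol' one_pos (by norm_num)
    h3' hM' (le_refl (1 : ℝ))
  have hkato : IsKatoSolutionOn 1 1 (u (0 + (-1))) (fun s => u (s + (-1))) := by
    refine ⟨hmild, ⟨fun s hs => h3' s ⟨by linarith [hs.1], hs.2⟩, fun s₀ hs₀ => ?_⟩, rfl, ?_⟩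
    · have hneg : s₀ + (-1) < 0 := by linarith [hs₀.2]
      have hg : Tendsto (fun s : ℝ => s + (-1)) (𝓝[Ico 0 1] s₀) (𝓝[Iio 0] (s₀ + (-1))) :=
        (continuous_id.add continuous_const).continuousWithinAt.tendsto_nhdsWithin fun s hs => by
          show s + (-1) < 0; linarith [hs.2]
      exact (hcont _ hneg).comp hg
    · refine ContinuousOn.aestronglyMeasurable ?_ (measurableSet_Ioo.prod MeasurableSet.univ)
      exact hsol'.smooth_velocity.continuousOn.mono
        (prod_mono (Ioo_subset_Ioo_left (by norm_num)) Subset.rfl)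
  -- far-field bound up to the final time, essential then pointwise
  obtain ⟨δ, hδ, R, hfar⟩ := IsKatoSolutionOn.farField_bound_holds one_pos one_pos hkato
  set V : Set (ℝ × EuclideanSpace ℝ (Fin 3)) :=
    Ioo (1 - δ) 1 ×ˢ (closedBall (0 : EuclideanSpace ℝ (Fin 3)) R)ᶜ with hV
  have hVo : IsOpen V := isOpen_Ioo.prod isClosed_closedBall.isOpen_compl
  have hVW : V ⊆ Iio 1 ×ˢ univ := prod_mono (fun s hs => hs.2) (subset_univ _)
  set M' : ℝ := (eLpNormEssSup (uncurry fun s => u (s + (-1))) (volume.restrict V)).toReal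
    with hM'def
  have hae : ∀ᵐ z ∂(volume.restrict V), ‖u (z.1 + (-1)) z.2‖ ≤ M' := by
    have hE : eLpNormEssSup (uncurry fun s => u (s + (-1))) (volume.restrict V) ≠ ⊤ := by
      rw [← eLpNorm_exponent_top]; exact hfar.ne
    filter_upwards [enorm_ae_le_eLpNormEssSup (uncurry fun s => u (s + (-1))) (volume.restrict V)]
      with z hz
    have := ENNReal.toReal_mono hE hz
    rwa [toReal_enorm] at this
  have hpt := forall_norm_le_of_ae_restrict' h1.smooth_velocity.continuousOn hVo hVW hae
  -- back to `u`: bounded on `(-δ, 0) × {|y| > R}`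
  have hfar' : ∀ s ∈ Ioo (-δ) 0, ∀ y : EuclideanSpace ℝ (Fin 3), R < ‖y‖ → ‖u s y‖ ≤ M' := by
    intro s hs y hy
    have hz : ((s + 1, y) : ℝ × EuclideanSpace ℝ (Fin 3)) ∈ V := by
      refine ⟨⟨by linarith [hs.1], by linarith [hs.2]⟩, ?_⟩
      show y ∈ (closedBall (0 : EuclideanSpace ℝ (Fin 3)) R)ᶜ
      rw [mem_compl_iff, mem_closedBall_zero_iff, not_le]
      exact hy
    have := hpt _ hz
    simp only [add_neg_cancel_right] at this
    exact this
  exact hsol.exists_hasTypeIDecay_of_farField_bound hc hdss hδ hfar'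

end ChaeWolfDecay

/-- **Chae–Wolf 2017, Theorem 1.1, case `q = 3`: the instance `q = 3` of the body of the named
fact `chaeWolf2017_dss_typeI_decay`** (same binders, `ENNReal.ofReal 3 = 3`): for every `c > 1`,
every classical solution `(u, p)` of the unforced Navier–Stokes equations with viscosity `1` on
`(−∞, 0)` with slices in `C((−∞,0); L³(ℝ³))` which is `c`-DSS obeys `HasTypeIDecay C u` for
some `C`. [cite: ChaeWolf2017RemovingDSS, Theorem 1.1 with (1.5), case p = 3 (arXiv p. 3)] -/
theorem chaeWolf2017_dss_typeI_decay_three :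
    ∀ c : ℝ, 1 < c →
    ∀ (u : ℝ → EuclideanSpace ℝ (Fin 3) → EuclideanSpace ℝ (Fin 3))
      (p : ℝ → EuclideanSpace ℝ (Fin 3) → ℝ), IsClassicalNSSolutionOn (Iio 0) 1 0 u p →
      (∀ t < 0, MemLp (u t) (ENNReal.ofReal 3) volume) →
      (∀ t₀ < 0, Filter.Tendsto (fun t => eLpNorm (u t - u t₀) (ENNReal.ofReal 3) volume)
        (nhdsWithin t₀ (Iio 0)) (nhds 0)) →
      IsDiscretelySelfSimilar c u → ∃ C : ℝ, HasTypeIDecay C u := by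
  intro c hc u p hsol h3 hcont hdss
  have e3 : ENNReal.ofReal 3 = 3 := by norm_num
  rw [e3] at h3 hcont
  exact ChaeWolfDecay.exists_hasTypeIDecay_of_memLp_three hc hsol h3 hcont hdss

end Literature.Analysis.FluidPDE

end
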